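import Literature.RingTheory.TightClosure.TestElementsExist
import Literature.AlgebraicGeometry.Resolution.RegularLocalRingsFlatDescent
import Mathlib.RingTheory.Flat.FaithfullyFlat.Algebra
import Mathlib.RingTheory.RingHom.Flat
import Mathlib.RingTheory.RegularLocalRing.Defs
import Mathlib.RingTheory.Localization.AtPrime.Basic
import Mathlib.RingTheory.Localization.LocalizationLocalization
import HarnessLib

/-!
# Descended test exponents (crux `FrobeniusLadder.FRationalModification`, stub `stub_testExponent`)

Stub `stub_testExponent` of the skeleton `Sketch` (v8) for crux
stmt-ResolutionOfSingularities-15316 (route `ResolutionOfSingularities/FrobeniusLadder`, rung 3: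
F-rational models).

Hochster–Huneke 1989, Thm. 3.4 (tree: `Literature.RingTheory.TightClosure.HochsterHuneke1989_thm34`,
PROVED as `HochsterHuneke1989_thm34_holds`) produces test exponents for F-FINITE reduced rings:
`R` F-finite reduced of characteristic `p`, `c ∈ R°` with `R_c` regular ⇒ some `cⁿ` multiplies
the tight closure of every ideal back into the ideal. A stalk `S = 𝒪_{W,w}` of a variety over an
arbitrary field `k` of characteristic `p` is NOT F-finite when `k` is not; but it is, through
every finite subset, faithfully flat over a Noetherian F-finite ring `S₀` (spreading out). This
file DESCENDS the test exponent along such submodels: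

* `frobeniusPower_map` — Frobenius powers commute with extension of ideals along a ring
  homomorphism: `(I S)^[q] = (I^[q]) S` for `q = p^e`.
* `isRegularRing_away_of_faithfullyFlat` — for `R₀ → R` faithfully flat with `R₀` Noetherian and
  `g ∈ R₀`: if `R_g` is a regular ring then so is `(R₀)_g`. (A prime `Q` of `(R₀)_g` is `P₀ (R₀)_g`
  for a prime `P₀ ∌ g` of `R₀`; by faithful flatness `P₀ = P ∩ R₀` for a prime `P` of `R`, and
  `φ(g) ∉ P`, so `R_P` — a local ring of `R_g` — is regular; `(R₀)_{P₀} → R_P` is flat and local,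
  so `(R₀)_{P₀} ≅ ((R₀)_g)_Q` is regular by Matsumura, Thm. 23.7 (i), tree
  `IsRegularLocalRing.of_flat_ringHom`.)
* `stub_testExponent` — the stub: in a domain `S` of characteristic `p` with such submodels,
  `g ≠ 0` with `S_g` regular, for all `t : Fin m → S`, `y`, `c ≠ 0` there is ONE exponent `n` with:
  for all `a : Fin m → ℕ`, `b : ℕ`, if `c (y^b)^q ∈ (t₁^{a₁}, …, t_m^{a_m})^[q]` for all `q = p^e`,
  then `gⁿ y^b ∈ (t₁^{a₁}, …, t_m^{a_m})`. (Choose `S₀` through `{g, y, c, t_i}`; `S₀ ⊆ S` is a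
  Noetherian F-finite domain of characteristic `p` with `(S₀)_g` regular; Hochster–Huneke gives
  `n`; the memberships descend to `S₀` by `Ideal.comap_map_eq_self_of_faithfullyFlat` and
  `frobeniusPower_map`, so `y₀^b ∈ ((t₀^a))^*` in `S₀`, `g₀ⁿ y₀^b ∈ (t₀^a)`, and we map back to `S`.)

References: M. Hochster, C. Huneke, *Tight closure and strong F-regularity*, Mém. Soc. Math.
France 38 (1989) 119–133, Thm. 3.4; H. Matsumura, *Commutative Ring Theory*, CUP 1986/87,
Thm. 23.7 (i).
-/

-- single-problem summit: the doubled namespace component `ResolutionOfSingularities` is forced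
set_option linter.dupNamespace false

noncomputable section

open IsLocalRing Literature.RingTheory.TightClosure Literature.AlgebraicGeometry.Resolution

namespace Summit.ResolutionOfSingularities.ResolutionOfSingularities.Theorems.FRationalModification.TestExponent

universe u

/-! ## Frobenius powers commute with extension of ideals -/

/-- **Frobenius powers commute with extension**: for a ring homomorphism `f : A → B` of rings of
exponential characteristic `p`, an ideal `I ⊆ A` and `q = p^e`, `(I B)^[q] = (I^[q]) B` — both are
the extension of `I` along `F^e ∘ f = f ∘ F^e`. [folklore] -/
theorem frobeniusPower_map {A B : Type*} [CommRing A] [CommRing B] (p : ℕ) [ExpChar A p]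
    [ExpChar B p] (f : A →+* B) (e : ℕ) (I : Ideal A) :
    frobeniusPower (p ^ e) (I.map f) = (frobeniusPower (p ^ e) I).map f := by
  rw [frobeniusPower_eq_map_iterateFrobenius p, frobeniusPower_eq_map_iterateFrobenius p,
    Ideal.map_map, Ideal.map_map]
  congr 1
  ext x
  simp only [RingHom.coe_comp, Function.comp_apply, iterateFrobenius_def, map_pow]

/-! ## Regularity of `(R₀)_g` descends along a faithfully flat `R₀ → R` -/

/-- **Regularity of a principal localisation descends along a faithfully flat map.** Let
`R₀ → R` be faithfully flat, `R₀` Noetherian, `g ∈ R₀`. If `R_g` (`g` viewed in `R`) is a regular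
ring, then `(R₀)_g` is a regular ring: a prime `Q` of `(R₀)_g` is the extension of a prime
`P₀ ∌ g` of `R₀`, which by faithful flatness is `P ∩ R₀` for a prime `P` of `R`
(`Ideal.exists_isPrime_liesOver_of_faithfullyFlat`); `g ∉ P`, so `R_P`, a local ring of the
regular ring `R_g`, is regular; and `(R₀)_{P₀} → R_P` is a flat local homomorphism
(`RingHom.Flat.localRingHom`), so `((R₀)_g)_Q ≅ (R₀)_{P₀}` is regular by Matsumura, Thm. 23.7 (i).
[cite: Matsumura1987, Thm. 23.7 (i)] -/
theorem isRegularRing_away_of_faithfullyFlat {R₀ R : Type u} [CommRing R₀] [CommRing R]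
    [IsNoetherianRing R₀] [Algebra R₀ R] [Module.FaithfullyFlat R₀ R] (g : R₀)
    (hreg : IsRegularRing (Localization.Away (algebraMap R₀ R g))) :
    IsRegularRing (Localization.Away g) := by
  haveI := hreg
  let R₀g := Localization.Away g
  refine (isRegularRing_iff (R := R₀g)).mpr fun Q _ => ?_
  -- the prime `P₀ = Q ∩ R₀` does not contain `g`, and `((R₀)_g)_Q = (R₀)_{P₀}`
  let P₀ : Ideal R₀ := Q.comap (algebraMap R₀ R₀g)
  haveI : P₀.IsPrime := Ideal.IsPrime.comap _
  have hgP₀ : g ∉ P₀ := fun hg =>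
    (IsLocalization.isPrime_iff_isPrime_disjoint (Submonoid.powers g) R₀g Q).mp ‹Q.IsPrime› |>.2
      |>.le_bot ⟨Submonoid.mem_powers g, hg⟩
  haveI : IsLocalization.AtPrime (Localization.AtPrime Q) P₀ :=
    IsLocalization.isLocalization_isLocalization_atPrime_isLocalization (Submonoid.powers g)
      (Localization.AtPrime Q) Q
  -- a prime `P` of `R` over `P₀` (faithful flatness); `g ∉ P`, so `R_P` is regular
  obtain ⟨P, hP, hPover⟩ := Ideal.exists_isPrime_liesOver_of_faithfullyFlat (B := R) P₀
  have hP₀ : P₀ = P.comap (algebraMap R₀ R) := hPover.over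
  have hgP : algebraMap R₀ R g ∉ P := fun h => hgP₀ (hP₀ ▸ Ideal.mem_comap.mpr h)
  haveI : IsRegularLocalRing (Localization.AtPrime P) :=
    FrobeniusPushforward.isRegularLocalRing_atPrime_of_isRegularRing_away P hgP
  -- the flat local homomorphism `(R₀)_{P₀} → R_P`: Matsumura 23.7 (i)
  have hf : (Localization.localRingHom P₀ P (algebraMap R₀ R) hP₀).Flat :=
    RingHom.Flat.localRingHom (RingHom.flat_algebraMap_iff.mpr inferInstance) P P₀ hP₀
  haveI : IsRegularLocalRing (Localization.AtPrime P₀) :=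
    IsRegularLocalRing.of_flat_ringHom (Localization.localRingHom P₀ P (algebraMap R₀ R) hP₀) hf
  exact IsRegularLocalRing.of_ringEquiv
    (IsLocalization.algEquiv P₀.primeCompl (Localization.AtPrime P₀)
      (Localization.AtPrime Q)).toRingEquiv

/-! ## The stub: descended test exponents -/

/-- **Descended test exponents** — stub `stub_testExponent` of crux `FRationalModification`, line
`Sketch`. `S` a domain of characteristic `p` admitting, through every finite subset, a faithfully
flat Noetherian F-finite submodel (`S₀ → S` faithfully flat, `S₀` Noetherian and F-finite, the
subset in the image); `g ≠ 0` with `S[1/g]` a regular ring. Then for all `t : Fin m → S`, `y` and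
`c ≠ 0` there is ONE exponent `n` such that for all exponent vectors `a` and all `b`: if `c`
witnesses `y^b ∈ (t₁^{a₁}, …, t_m^{a_m})^*` (`c (y^b)^q ∈ (t^a)^[q]` for all `q`), then
`gⁿ y^b ∈ (t^a)`. Proof: choose `S₀` through `{g, t_i, y, c}`; `S₀` embeds in `S`, so it is a
domain of characteristic `p`, `g₀ ≠ 0`, and `S₀[1/g₀]` is regular
(`isRegularRing_away_of_faithfullyFlat`: faithful flatness and Matsumura 23.7 (i)); so
Hochster–Huneke 1989 Thm 3.4 (tree `HochsterHuneke1989_thm34_holds`) gives `n` with `g₀ⁿ I^* ⊆ I`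
for every ideal `I ⊆ S₀`; the memberships `c (y^b)^q ∈ (t^a)^[q]` descend to `S₀`
(`Ideal.comap_map_eq_self_of_faithfullyFlat`, `frobeniusPower_map`), so `y₀^b ∈ ((t₀^a))^*` in
`S₀` and `gⁿ y^b ∈ (t^a)`. [cite: HochsterHuneke1989, Thm. 3.4] -/
theorem stub_testExponent (p : ℕ) [Fact p.Prime] {S : Type} [CommRing S] [IsDomain S] [CharP S p]
    (hmod : ∀ F : Finset S, ∃ (S₀ : Type) (_ : CommRing S₀) (_ : Algebra S₀ S),
      IsNoetherianRing S₀ ∧ IsFFinite p 1 S₀ ∧ Module.FaithfullyFlat S₀ S ∧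
        (↑F : Set S) ⊆ Set.range (algebraMap S₀ S))
    {g : S} (hg0 : g ≠ 0) (hreg : IsRegularRing (Localization.Away g))
    {m : ℕ} (t : Fin m → S) (y c : S) (hc : c ≠ 0) :
    ∃ n : ℕ, ∀ (a : Fin m → ℕ) (b : ℕ),
      (∀ e : ℕ, c * (y ^ b) ^ p ^ e ∈
        frobeniusPower (p ^ e) (Ideal.span (Set.range fun i => t i ^ a i))) →
      g ^ n * y ^ b ∈ Ideal.span (Set.range fun i => t i ^ a i) := by
  classical
  -- (1) a submodel `S₀` through `{g, y, c, t_i}`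
  obtain ⟨S₀, _, _, hN, hF, hff, hsub⟩ :=
    hmod (insert g (insert y (insert c (Finset.univ.image t))))
  have hmem : ∀ z : S, z ∈ insert g (insert y (insert c (Finset.univ.image t))) →
      ∃ z₀ : S₀, algebraMap S₀ S z₀ = z := fun z hz => hsub (Finset.mem_coe.mpr hz)
  obtain ⟨g₀, rfl⟩ := hmem g (by simp)
  obtain ⟨y₀, rfl⟩ := hmem y (by simp)
  obtain ⟨c₀, rfl⟩ := hmem c (by simp)
  have ht : ∀ i, ∃ z₀ : S₀, algebraMap S₀ S z₀ = t i := fun i => hmem (t i) (by simp)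
  choose t₀ ht₀ using ht
  obtain rfl : (fun i => algebraMap S₀ S (t₀ i)) = t := funext ht₀
  -- (2) `S₀ ↪ S`: `S₀` is a Noetherian F-finite domain of characteristic `p`
  have hinj : Function.Injective (algebraMap S₀ S) := FaithfulSMul.algebraMap_injective S₀ S
  haveI : IsDomain S₀ := Function.Injective.isDomain (algebraMap S₀ S) hinj
  haveI : CharP S₀ p := (algebraMap S₀ S).charP hinj p
  haveI : IsNoetherianRing S₀ := hN
  have hg₀ : g₀ ≠ 0 := fun h => hg0 (by rw [h, map_zero])
  have hc₀ : c₀ ≠ 0 := fun h => hc (by rw [h, map_zero])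
  -- (3) `(S₀)_{g₀}` is regular, (4) Hochster–Huneke 1989, Thm. 3.4 in `S₀`
  have hreg₀ : IsRegularRing (Localization.Away g₀) := isRegularRing_away_of_faithfullyFlat g₀ hreg
  obtain ⟨n, hn⟩ :=
    HochsterHuneke1989_thm34_holds p S₀ hF g₀ (mem_nonZeroDivisors_of_ne_zero hg₀) hreg₀
  refine ⟨n, fun a b hab => ?_⟩
  -- (5) descend the memberships to `S₀`
  set I₀ : Ideal S₀ := Ideal.span (Set.range fun i => t₀ i ^ a i) with hI₀
  have hI : Ideal.span (Set.range fun i => algebraMap S₀ S (t₀ i) ^ a i) =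
      I₀.map (algebraMap S₀ S) := by
    rw [hI₀, Ideal.map_span, ← Set.range_comp]
    simp only [Function.comp_def, map_pow]
  have hy₀ : y₀ ^ b ∈ tightClosure p I₀ := by
    refine mem_tightClosure_of_forall p (mem_minimalPrimesCompl_iff_ne_zero.mpr hc₀) fun e => ?_
    have h := hab e
    rw [hI, frobeniusPower_map p (algebraMap S₀ S) e I₀, ← map_pow, ← map_pow, ← map_mul,
      ← Ideal.mem_comap, Ideal.comap_map_eq_self_of_faithfullyFlat] at h
    exact h
  -- (6) conclude in `S₀` and map back to `S`
  have h₀ : g₀ ^ n * y₀ ^ b ∈ I₀ := hn I₀ _ hy₀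
  have h₁ := Ideal.mem_map_of_mem (algebraMap S₀ S) h₀
  rw [map_mul, map_pow, map_pow, ← hI] at h₁
  exact h₁

end Summit.ResolutionOfSingularities.ResolutionOfSingularities.Theorems.FRationalModification.TestExponent

end
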